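import Mathlib.GroupTheory.FiniteAbelian.Duality
import HarnessLib

/-!
# `#K · #K^⊥ = #G` for a perfect pairing of finite abelian groups INTO UNITS

Layer `Literature/GroupTheory/Abelian`, namespace `Literature.GroupTheory.Abelian.PerfectPairingUnits`.  THEOREMS ONLY (no
definition, no instance, no named fact).  Siblings: `ZModPairingAnnihilatorCard` (the COORDINATE form `(ι → ℤ/n)` with a
unit-determinant matrix) and `PerfectPairingAnnihilatorCard` (the abstract ADDITIVE form `e : G →+ H →+ ZMod n`, proved by
character sums); this file is the abstract MULTIPLICATIVE / units-valued form: two finite commutative groups `G`, `H`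
(written multiplicatively, as the section groups `A.Sections` of the abelian-scheme files are) and a bilinear pairing

  `e : G →* H →* Mˣ`

into the units of a commutative monoid `M` having enough roots of unity (Mathlib `HasEnoughRootsOfUnity`; e.g. `M = Ω` a
separably closed field with `(n : Ω) ≠ 0`, Mathlib `IsSepClosed.hasEnoughRootsOfUnity`).  The model case is the Weil
`e_n`-pairing `A[n] × Â[n] → μ_n` of an abelian variety and its dual ([MumfordAV1970] §20 p. 184, §23 p. 233: `e_n` is a
non-degenerate pairing; for a subgroup `K` its annihilator `K^⊥` has order `#A[n] / #K`).

Everything is glue over Mathlib's duality theory of finite abelian groups (`Mathlib.GroupTheory.FiniteAbelian.Duality`: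
`CommGroup.card_monoidHom_of_hasEnoughRootsOfUnity : #(G →* Mˣ) = #G`).

* §1 (private) non-degeneracy as injectivity of `e` / `e.flip`;
* §2 **`card_le_card_of_left_nondegenerate`**, **`card_eq_card_of_perfect`** (`#G = #H`), **`bijective_of_perfect`** /
  **`flip_bijective_of_perfect`** (`G ≃ (H →* Mˣ)`, `H ≃ (G →* Mˣ)`);
* §3 THE BRICK **`card_mul_card_eq_card_of_nondegenerate_on`**: for `K ≤ G` on which `e` is non-degenerate and ANY
  subgroup `K' ≤ H` with the membership clause `h ∈ K' ↔ ∀ k ∈ K, e k h = 1` (the annihilator `K^⊥`, in whatever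
  spelling the consumer has), `#K · #K' = #H`; two-sided version **`card_mul_card_eq_card_of_perfect`** (`= #G`);
* §4 the same with the roots-of-unity hypothesis stated at ONE level `n` killing `G` and `H`
  (**`card_mul_card_eq_card_of_perfect_of_pow_eq_one`**), the form used at a geometric point (`gⁿ = 1` on `A[n](Ω)`).

Proof of §3: `e` descends to a PERFECT pairing `K × (H ⧸ K') → Mˣ`, so `#K = #(H ⧸ K')` by §2, and Lagrange.

## References

* [MumfordAV1970] D. Mumford, *Abelian Varieties* (1970), §20 (p. 184) and §23 (p. 233): the `e_n`-pairing is
  non-degenerate; orders of annihilators / maximal isotropic subgroups.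
* [SerreLinearRepresentations1977] J.-P. Serre, *Linear Representations of Finite Groups* (1977), §2.3: duality of
  finite abelian groups via characters (the Mathlib engine).
-/

namespace Literature.GroupTheory.Abelian.PerfectPairingUnits

open MonoidHom

variable {G H M : Type*} [CommGroup G] [CommGroup H] [CommMonoid M] (e : G →* H →* Mˣ)

/-! ### §1 Non-degeneracy as injectivity -/

/-- Left non-degeneracy (`e g · = 1 ⇒ g = 1`) is injectivity of `e : G → (H →* Mˣ)`. [folklore] -/
private theorem injective_of_left_nondegenerate (hl : ∀ g : G, (∀ h : H, e g h = 1) → g = 1) :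
    Function.Injective e :=
  (injective_iff_map_eq_one e).mpr fun g hg => hl g fun h => by rw [hg, MonoidHom.one_apply]

/-- Right non-degeneracy (`e · h = 1 ⇒ h = 1`) is injectivity of `e.flip : H → (G →* Mˣ)`. [folklore] -/
private theorem flip_injective_of_right_nondegenerate (hr : ∀ h : H, (∀ g : G, e g h = 1) → h = 1) :
    Function.Injective e.flip :=
  (injective_iff_map_eq_one e.flip).mpr fun h hh => hr h fun g => by
    rw [← MonoidHom.flip_apply e, hh, MonoidHom.one_apply]

/-! ### §2 Cardinalities under non-degeneracy -/

section Finite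

variable [Finite G] [Finite H]

omit [Finite G] in
/-- A left non-degenerate pairing `G × H → Mˣ` (enough roots of unity in `M` for the exponent of `H`) forces
`#G ≤ #H`: `G` embeds in the character group `H →* Mˣ`, which has `#H` elements
(Mathlib `CommGroup.card_monoidHom_of_hasEnoughRootsOfUnity`). [cite: MumfordAV1970, §23 (p. 233)] -/
theorem card_le_card_of_left_nondegenerate [HasEnoughRootsOfUnity M (Monoid.exponent H)]
    (hl : ∀ g : G, (∀ h : H, e g h = 1) → g = 1) : Nat.card G ≤ Nat.card H := by
  have hcard : Nat.card (H →* Mˣ) = Nat.card H := CommGroup.card_monoidHom_of_hasEnoughRootsOfUnity H M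
  have : Finite (H →* Mˣ) := Nat.finite_of_card_ne_zero (hcard ▸ Nat.card_pos.ne')
  rw [← hcard]
  exact Nat.card_le_card_of_injective e (injective_of_left_nondegenerate e hl)

omit [Finite H] in
/-- A right non-degenerate pairing `G × H → Mˣ` (enough roots of unity in `M` for the exponent of `G`) forces
`#H ≤ #G`. [cite: MumfordAV1970, §23 (p. 233)] -/
theorem card_le_card_of_right_nondegenerate [HasEnoughRootsOfUnity M (Monoid.exponent G)]
    (hr : ∀ h : H, (∀ g : G, e g h = 1) → h = 1) : Nat.card H ≤ Nat.card G :=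
  card_le_card_of_left_nondegenerate e.flip fun h hh => hr h fun g => by rw [← MonoidHom.flip_apply e]; exact hh g

/-- **A perfect pairing of finite abelian groups matches the orders: `#G = #H`.** [cite: MumfordAV1970, §23 (p. 233)] -/
theorem card_eq_card_of_perfect [HasEnoughRootsOfUnity M (Monoid.exponent G)]
    [HasEnoughRootsOfUnity M (Monoid.exponent H)]
    (hl : ∀ g : G, (∀ h : H, e g h = 1) → g = 1) (hr : ∀ h : H, (∀ g : G, e g h = 1) → h = 1) :
    Nat.card G = Nat.card H :=
  le_antisymm (card_le_card_of_left_nondegenerate e hl) (card_le_card_of_right_nondegenerate e hr)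

/-- For a perfect pairing, `e : G → (H →* Mˣ)` is a bijection (`G` IS the character group of `H`).
[cite: MumfordAV1970, §23 (p. 233)] -/
theorem bijective_of_perfect [HasEnoughRootsOfUnity M (Monoid.exponent G)]
    [HasEnoughRootsOfUnity M (Monoid.exponent H)]
    (hl : ∀ g : G, (∀ h : H, e g h = 1) → g = 1) (hr : ∀ h : H, (∀ g : G, e g h = 1) → h = 1) :
    Function.Bijective e := by
  have hcard : Nat.card (H →* Mˣ) = Nat.card H := CommGroup.card_monoidHom_of_hasEnoughRootsOfUnity H M
  have : Finite (H →* Mˣ) := Nat.finite_of_card_ne_zero (hcard ▸ Nat.card_pos.ne')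
  exact (Nat.bijective_iff_injective_and_card e).mpr
    ⟨injective_of_left_nondegenerate e hl, by rw [hcard, card_eq_card_of_perfect e hl hr]⟩

/-- For a perfect pairing, `e.flip : H → (G →* Mˣ)` is a bijection (`H` IS the character group of `G`).
[cite: MumfordAV1970, §23 (p. 233)] -/
theorem flip_bijective_of_perfect [HasEnoughRootsOfUnity M (Monoid.exponent G)]
    [HasEnoughRootsOfUnity M (Monoid.exponent H)]
    (hl : ∀ g : G, (∀ h : H, e g h = 1) → g = 1) (hr : ∀ h : H, (∀ g : G, e g h = 1) → h = 1) :
    Function.Bijective e.flip :=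
  bijective_of_perfect e.flip (fun h hh => hr h fun g => by rw [← MonoidHom.flip_apply e]; exact hh g)
    fun g hg => hl g fun h => by have hgh := hg h; rwa [MonoidHom.flip_apply] at hgh

/-! ### §3 The annihilator count -/

/-- **`#K · #K^⊥ = #H`** — for a bilinear pairing `e : G × H → Mˣ` of finite abelian groups, a subgroup `K ≤ G` on which
`e` is non-degenerate (`k ∈ K`, `e k · = 1 ⇒ k = 1`), and ANY subgroup `K' ≤ H` whose membership clause is
«`h ∈ K' ↔ ∀ k ∈ K, e k h = 1`» (the annihilator of `K`, in the consumer's own spelling), one has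
`Nat.card K * Nat.card K' = Nat.card H` (enough roots of unity in `M` for the exponents of `G` and `H`).  Proof: `e`
descends to a perfect pairing `K × (H ⧸ K') → Mˣ`, so `#K = #(H ⧸ K')` (`card_eq_card_of_perfect`), and Lagrange.
[cite: MumfordAV1970, §23 (p. 233)] -/
theorem card_mul_card_eq_card_of_nondegenerate_on [HasEnoughRootsOfUnity M (Monoid.exponent G)]
    [HasEnoughRootsOfUnity M (Monoid.exponent H)] (K : Subgroup G) (K' : Subgroup H)
    (hK' : ∀ h : H, h ∈ K' ↔ ∀ k ∈ K, e k h = 1) (hl : ∀ k ∈ K, (∀ h : H, e k h = 1) → k = 1) :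
    Nat.card K * Nat.card K' = Nat.card H := by
  have : HasEnoughRootsOfUnity M (Monoid.exponent K) :=
    HasEnoughRootsOfUnity.of_dvd M (Monoid.exponent_submonoid_dvd K.toSubmonoid)
  have : HasEnoughRootsOfUnity M (Monoid.exponent (H ⧸ K')) :=
    HasEnoughRootsOfUnity.of_dvd M (Group.exponent_quotient_dvd K')
  -- the descended pairing `K × (H ⧸ K') → Mˣ`
  have hker : ∀ k : K, K' ≤ (e (k : G)).ker := fun k h hh => (hK' h).mp hh k k.2
  let ē : K →* (H ⧸ K') →* Mˣ :=
    { toFun := fun k => QuotientGroup.lift K' (e (k : G)) (hker k)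
      map_one' := by
        refine QuotientGroup.monoidHom_ext _ (MonoidHom.ext fun h => ?_)
        simp only [MonoidHom.comp_apply, QuotientGroup.mk'_apply, QuotientGroup.lift_mk, OneMemClass.coe_one,
          map_one, MonoidHom.one_apply]
      map_mul' := fun k₁ k₂ => by
        refine QuotientGroup.monoidHom_ext _ (MonoidHom.ext fun h => ?_)
        simp only [MonoidHom.comp_apply, QuotientGroup.mk'_apply, QuotientGroup.lift_mk, Subgroup.coe_mul, map_mul,
          MonoidHom.mul_apply] }
  have hē : ∀ (k : K) (h : H), ē k (h : H ⧸ K') = e (k : G) h := fun k h => rfl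
  have hl' : ∀ k : K, (∀ q : H ⧸ K', ē k q = 1) → k = 1 := fun k hk =>
    Subtype.ext (hl k k.2 fun h => by rw [← hē]; exact hk h)
  have hr' : ∀ q : H ⧸ K', (∀ k : K, ē k q = 1) → q = 1 := by
    intro q hq
    induction q using QuotientGroup.induction_on with
    | H h => exact (QuotientGroup.eq_one_iff h).mpr ((hK' h).mpr fun k hk => by rw [← hē ⟨k, hk⟩]; exact hq ⟨k, hk⟩)
  rw [card_eq_card_of_perfect ē hl' hr']
  exact (Subgroup.card_eq_card_quotient_mul_card_subgroup K').symm

/-- **`#K · #K^⊥ = #G`** for a PERFECT pairing `e : G × H → Mˣ` of finite abelian groups, any subgroup `K ≤ G` and any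
subgroup `K' ≤ H` with membership clause «`h ∈ K' ↔ ∀ k ∈ K, e k h = 1`» (the annihilator of `K`).
[cite: MumfordAV1970, §23 (p. 233)] -/
theorem card_mul_card_eq_card_of_perfect [HasEnoughRootsOfUnity M (Monoid.exponent G)]
    [HasEnoughRootsOfUnity M (Monoid.exponent H)]
    (hl : ∀ g : G, (∀ h : H, e g h = 1) → g = 1) (hr : ∀ h : H, (∀ g : G, e g h = 1) → h = 1)
    (K : Subgroup G) (K' : Subgroup H) (hK' : ∀ h : H, h ∈ K' ↔ ∀ k ∈ K, e k h = 1) :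
    Nat.card K * Nat.card K' = Nat.card G := by
  rw [card_eq_card_of_perfect e hl hr]
  exact card_mul_card_eq_card_of_nondegenerate_on e K K' hK' fun k _ hk => hl k hk

/-- The mirror count **`#K'^⊥ · #K' = #G`** for a subgroup `K' ≤ H` of the RIGHT factor on which `e` is non-degenerate and
its annihilator `K ≤ G` («`g ∈ K ↔ ∀ k' ∈ K', e g k' = 1`»). [cite: MumfordAV1970, §23 (p. 233)] -/
theorem card_mul_card_eq_card_of_nondegenerate_on_right [HasEnoughRootsOfUnity M (Monoid.exponent G)]
    [HasEnoughRootsOfUnity M (Monoid.exponent H)] (K : Subgroup G) (K' : Subgroup H)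
    (hK : ∀ g : G, g ∈ K ↔ ∀ k' ∈ K', e g k' = 1) (hr : ∀ k' ∈ K', (∀ g : G, e g k' = 1) → k' = 1) :
    Nat.card K * Nat.card K' = Nat.card G := by
  rw [mul_comm]
  exact card_mul_card_eq_card_of_nondegenerate_on e.flip K' K
    (fun g => by simp only [MonoidHom.flip_apply]; exact hK g)
    fun k' hk' h => hr k' hk' fun g => by rw [← MonoidHom.flip_apply e]; exact h g

/-! ### §4 One level `n` killing both groups -/

omit [Finite G] in
/-- Enough `n`-th roots of unity serve every commutative group killed by `n`. [folklore] -/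
private theorem hasEnoughRootsOfUnity_exponent_of_pow_eq_one {n : ℕ} [NeZero n] [HasEnoughRootsOfUnity M n]
    (hG : ∀ g : G, g ^ n = 1) : HasEnoughRootsOfUnity M (Monoid.exponent G) :=
  HasEnoughRootsOfUnity.of_dvd M (Monoid.exponent_dvd_of_forall_pow_eq_one hG)

/-- **`#K · #K^⊥ = #G` at one level `n`**: `G`, `H` finite abelian groups killed by `n` (`gⁿ = 1`, `hⁿ = 1`), `M` with
enough `n`-th roots of unity (e.g. a separably closed field `Ω` with `(n : Ω) ≠ 0`), `e : G × H → Mˣ` perfect, `K ≤ G`,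
and `K' ≤ H` its annihilator by membership clause.  This is the form met by the `e_n`-pairing `A[n](Ω) × Â[n](Ω) → Ωˣ`
at a geometric point. [cite: MumfordAV1970, §23 (p. 233)] -/
theorem card_mul_card_eq_card_of_perfect_of_pow_eq_one {n : ℕ} [NeZero n] [HasEnoughRootsOfUnity M n]
    (hG : ∀ g : G, g ^ n = 1) (hH : ∀ h : H, h ^ n = 1)
    (hl : ∀ g : G, (∀ h : H, e g h = 1) → g = 1) (hr : ∀ h : H, (∀ g : G, e g h = 1) → h = 1)
    (K : Subgroup G) (K' : Subgroup H) (hK' : ∀ h : H, h ∈ K' ↔ ∀ k ∈ K, e k h = 1) :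
    Nat.card K * Nat.card K' = Nat.card G := by
  have := hasEnoughRootsOfUnity_exponent_of_pow_eq_one (G := G) (M := M) hG
  have := hasEnoughRootsOfUnity_exponent_of_pow_eq_one (G := H) (M := M) hH
  exact card_mul_card_eq_card_of_perfect e hl hr K K' hK'

/-- **`#G = #H` at one level `n`** for a perfect pairing of finite abelian groups killed by `n`.
[cite: MumfordAV1970, §23 (p. 233)] -/
theorem card_eq_card_of_perfect_of_pow_eq_one {n : ℕ} [NeZero n] [HasEnoughRootsOfUnity M n]
    (hG : ∀ g : G, g ^ n = 1) (hH : ∀ h : H, h ^ n = 1)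
    (hl : ∀ g : G, (∀ h : H, e g h = 1) → g = 1) (hr : ∀ h : H, (∀ g : G, e g h = 1) → h = 1) :
    Nat.card G = Nat.card H := by
  have := hasEnoughRootsOfUnity_exponent_of_pow_eq_one (G := G) (M := M) hG
  have := hasEnoughRootsOfUnity_exponent_of_pow_eq_one (G := H) (M := M) hH
  exact card_eq_card_of_perfect e hl hr

/-- **`#K · #K^⊥ = #H` at one level `n`, one-sided**: only non-degeneracy of `e` on `K` is needed when the right-hand
side is the order of the group `H` in which the annihilator lives. [cite: MumfordAV1970, §23 (p. 233)] -/
theorem card_mul_card_eq_card_of_nondegenerate_on_of_pow_eq_one {n : ℕ} [NeZero n] [HasEnoughRootsOfUnity M n]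
    (hG : ∀ g : G, g ^ n = 1) (hH : ∀ h : H, h ^ n = 1) (K : Subgroup G) (K' : Subgroup H)
    (hK' : ∀ h : H, h ∈ K' ↔ ∀ k ∈ K, e k h = 1) (hl : ∀ k ∈ K, (∀ h : H, e k h = 1) → k = 1) :
    Nat.card K * Nat.card K' = Nat.card H := by
  have := hasEnoughRootsOfUnity_exponent_of_pow_eq_one (G := G) (M := M) hG
  have := hasEnoughRootsOfUnity_exponent_of_pow_eq_one (G := H) (M := M) hH
  exact card_mul_card_eq_card_of_nondegenerate_on e K K' hK' hl

end Finite

end Literature.GroupTheory.Abelian.PerfectPairingUnits
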